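import Mathlib
import Literature.Geometry.Kaehler.Kaehler
import Literature.Geometry.Kaehler.AnalyticSetRegular
import Literature.Geometry.Kaehler.AnalyticSetComponentsProofs
import Literature.NumberTheory.Transcendental.ComplexFormsPullback
import Summits.HodgeConjecture.HodgeConjecture.Theorems.HolomorphicityRateSuperThresholdRigidityKerLeOfEqOnZeroSet
import Summits.HodgeConjecture.HodgeConjecture.Theorems.HolomorphicityRateSuperThresholdRigidityEventuallySurjectiveFderiv
import Summits.HodgeConjecture.HodgeConjecture.Theorems.HolomorphicityRateSuperThresholdRigidityIsRegPtOfContDiffOnComplexKer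
import HarnessLib

/-!
# Route `HolomorphicityRate`, crux `SuperThresholdRigidity` (stmt-HodgeConjecture-2737) — stub 2d (manifold transport)

On a complex manifold `M` charted on the finite-dimensional complex space `E` (holomorphic atlas,
hence also a real `C^∞` atlas for `𝓘(ℝ, E)`), a set `S` which near every point of `S ∖ Sg`
(`Sg` closed) is the zero set of a real `C¹` submersion `f : M → ℝ^{2p}` whose kernel `ker df_x`
is stable under `J = tangentJ E x` has every point of `S ∖ Sg` as a regular point of complex
codimension `p`. The proof reads `f` in the extended chart at `x` and combines the three landed
model-space lemmas of the line (`stub_kerLeOfEqOnZeroSet`, `stub_eventually_surjective_fderiv`,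
`stub_isRegPt_of_contDiffOn_complexKer`) with the `ℂ`-linearity of the tangent coordinate changes
of a holomorphic atlas (`Literature.NumberTheory.Transcendental.mfderiv_real_apply_smul`) and the
chart-image transfer `Literature.Geometry.Kaehler.isRegularPointOfCodim_of_isRegPt_chartImage`.
Helper (`--supports stmt-HodgeConjecture-2737`) for the recognition half of the crux skeleton
`Cruxes/SuperThresholdRigidity/Lines/birth.lean` (stub `stub_goodPointRegular`).

## References

* E. M. Chirka, *Complex Analytic Sets*, Kluwer (1989), §2.3 [Chirka1989].
* C. Voisin, *Hodge Theory and Complex Algebraic Geometry I* (2002), §2.2.1 [VoisinHodgeI2002].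
-/

-- the problem path `HodgeConjecture/HodgeConjecture` (single-problem summit) repeats a namespace segment
set_option linter.dupNamespace false

open scoped Manifold Topology ContDiff
open Set Filter

namespace Summit.HodgeConjecture.HodgeConjecture.Theorems

section ChartCalculus

variable {E : Type*} [NormedAddCommGroup E] [NormedSpace ℝ E]
  {M : Type*} [TopologicalSpace M] [ChartedSpace E M] [IsManifold 𝓘(ℝ, E) 1 M]
  {F : Type*} [NormedAddCommGroup F] [NormedSpace ℝ F]

/-- **Chain rule in an extended chart (real version).** For `y` in the source of the extended chart
`c = extChartAt 𝓘(ℝ, E) x` and `g : M → F` whose written function `g ∘ c.symm` is differentiable at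
`c y`, the manifold derivative of `g` at `y` is `D(g ∘ c.symm)(c y) ∘ Dc(y)`. Real analogue of the
tree's `Literature.Geometry.Kaehler.mfderiv_eq_fderiv_comp_mfderiv_extChartAt`. [folklore] -/
theorem mfderiv_eq_fderiv_comp_mfderiv_extChartAt_real {g : M → F} {x y : M}
    (hy : y ∈ (extChartAt 𝓘(ℝ, E) x).source)
    (hG : DifferentiableAt ℝ (g ∘ (extChartAt 𝓘(ℝ, E) x).symm) (extChartAt 𝓘(ℝ, E) x y)) :
    mfderiv 𝓘(ℝ, E) 𝓘(ℝ, F) g y =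
      (fderiv ℝ (g ∘ (extChartAt 𝓘(ℝ, E) x).symm) (extChartAt 𝓘(ℝ, E) x y)).comp
        (mfderiv 𝓘(ℝ, E) 𝓘(ℝ, E) (extChartAt 𝓘(ℝ, E) x) y) := by
  have hy' : y ∈ (chartAt E x).source := by rwa [← extChartAt_source (I := 𝓘(ℝ, E))]
  have h1 : HasMFDerivAt 𝓘(ℝ, E) 𝓘(ℝ, F) (g ∘ (extChartAt 𝓘(ℝ, E) x).symm) (extChartAt 𝓘(ℝ, E) x y)
      (fderiv ℝ (g ∘ (extChartAt 𝓘(ℝ, E) x).symm) (extChartAt 𝓘(ℝ, E) x y)) :=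
    hasMFDerivAt_iff_hasFDerivAt.2 hG.hasFDerivAt
  have h2 : HasMFDerivAt 𝓘(ℝ, E) 𝓘(ℝ, E) (extChartAt 𝓘(ℝ, E) x) y
      (mfderiv 𝓘(ℝ, E) 𝓘(ℝ, E) (extChartAt 𝓘(ℝ, E) x) y) :=
    (mdifferentiableAt_extChartAt hy').hasMFDerivAt
  have h3 := h1.comp y h2
  have hev : g =ᶠ[𝓝 y] (g ∘ (extChartAt 𝓘(ℝ, E) x).symm) ∘ extChartAt 𝓘(ℝ, E) x := by
    filter_upwards [(isOpen_extChartAt_source (I := 𝓘(ℝ, E)) x).mem_nhds hy] with y' hy'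
    simp only [Function.comp_apply, (extChartAt 𝓘(ℝ, E) x).left_inv hy']
  exact (h3.congr_of_eventuallyEq hev).mfderiv

/-- The written function of a map which is real `C¹` (in the manifold sense) on an open set `U` is
`C¹`, in the extended chart `c = extChartAt 𝓘(ℝ, E) x`, on `c.target ∩ c.symm ⁻¹' U`. [folklore] -/
theorem contDiffOn_extChartAt_symm_of_contMDiffOn {g : M → F} {U : Set M}
    (hg : ContMDiffOn 𝓘(ℝ, E) 𝓘(ℝ, F) 1 g U) (x : M) :
    ContDiffOn ℝ 1 (g ∘ (extChartAt 𝓘(ℝ, E) x).symm)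
      ((extChartAt 𝓘(ℝ, E) x).target ∩ (extChartAt 𝓘(ℝ, E) x).symm ⁻¹' U) := by
  have h2 := (contMDiffOn_iff.1 hg).2 x 0
  simpa [mfld_simps] using h2

end ChartCalculus

/-- **Good points of a holomorphic support are regular of codimension `p` (manifold transport).**
On a complex manifold `M` charted on `E` (holomorphic atlas `𝓘(ℂ, E)`, real `C^∞` atlas
`𝓘(ℝ, E)`), let `Sg` be closed and suppose every `x ∈ S ∖ Sg` admits an open `U ∋ x` and a real
`C¹` map `f : M → ℝ^{2p}` on `U` with `S ∩ U = U ∩ f⁻¹(0)`, `df_x` onto and `ker df_x` stable under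
`J = tangentJ E x`. Then every point of `S ∖ Sg` is a regular point of complex codimension `p` of
`S`. Proof: read `f` in the chart `c` at `x`: `φ = f ∘ c.symm` is `C¹` on an open `W ∋ c x`, and
`mfderiv f y = dφ(c y) ∘ Dc(y)` with `Dc(y)` onto and commuting with `i` (the chart is
holomorphic); shrink `W` into the submersive locus of `φ` (`stub_eventually_surjective_fderiv`) and
off `Sg`; at a point `y` with `c y ∈ W ∩ c(S)` the chart reading `φ'` of the defining map AT `y`
cuts out the same set near `c y`, so `ker dφ(c y) = ker dφ'(c y)` (`stub_kerLeOfEqOnZeroSet`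
twice), which is `i`-stable; conclude by `stub_isRegPt_of_contDiffOn_complexKer` and
`isRegularPointOfCodim_of_isRegPt_chartImage`. [Chirka1989, §2.3; VoisinHodgeI2002, §2.2.1]
[folklore] -/
theorem stub_goodPointRegular : ∀ {E : Type*} [NormedAddCommGroup E] [NormedSpace ℂ E] [FiniteDimensional ℂ E] {M : Type*} [TopologicalSpace M] [ChartedSpace E M] [IsManifold 𝓘(ℂ, E) (⊤ : WithTop ℕ∞) M] [IsManifold 𝓘(ℝ, E) ((⊤ : ℕ∞) : WithTop ℕ∞) M] {p : ℕ} {S Sg : Set M}, IsClosed Sg → (∀ x ∈ S \ Sg, ∃ U : Set M, IsOpen U ∧ x ∈ U ∧ ∃ f : M → (Fin (2 * p) → ℝ), ContMDiffOn 𝓘(ℝ, E) 𝓘(ℝ, Fin (2 * p) → ℝ) 1 f U ∧ S ∩ U = U ∩ f ⁻¹' {0} ∧ Function.Surjective (mfderiv 𝓘(ℝ, E) 𝓘(ℝ, Fin (2 * p) → ℝ) f x) ∧ ∀ v : TangentSpace 𝓘(ℝ, E) x, mfderiv 𝓘(ℝ, E) 𝓘(ℝ, Fin (2 * p) → ℝ)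 f x v = 0 → mfderiv 𝓘(ℝ, E) 𝓘(ℝ, Fin (2 * p) → ℝ) f x (Literature.Geometry.Kaehler.tangentJ E x v) = 0) → ∀ x ∈ S \ Sg, Literature.Geometry.Kaehler.IsRegularPointOfCodim 𝓘(ℂ, E) S p x := by
  intro E _ _ _ M _ _ _ _ p S Sg hSg hgood x hx
  -- the extended chart at `x` (the same partial equivalence for `𝓘(ℂ, E)` and `𝓘(ℝ, E)`)
  set c := extChartAt 𝓘(ℂ, E) x with hc
  have hcR : extChartAt 𝓘(ℝ, E) x = c := rfl
  have hxs : x ∈ c.source := mem_extChartAt_source x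
  -- `Dc(y)` is onto and commutes with `i` at every point of the chart source
  have hD : ∀ y ∈ c.source, Function.Surjective (mfderiv 𝓘(ℝ, E) 𝓘(ℝ, E) c y) ∧
      ∀ v : E, mfderiv 𝓘(ℝ, E) 𝓘(ℝ, E) c y (Complex.I • v : E) =
        (Complex.I • (show E from mfderiv 𝓘(ℝ, E) 𝓘(ℝ, E) c y v) : E) := by
    intro y hy
    have hy' : y ∈ (chartAt E x).source := by rwa [← extChartAt_source (I := 𝓘(ℂ, E))]
    have hcdC : MDifferentiableAt 𝓘(ℂ, E) 𝓘(ℂ, E) c y := mdifferentiableAt_extChartAt hy'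
    refine ⟨?_, fun v => Literature.NumberTheory.Transcendental.mfderiv_real_apply_smul hcdC _ v⟩
    exact (isInvertible_mfderiv_extChartAt (I := 𝓘(ℝ, E)) (x := x) hy).surjective
  -- reading a local defining submersion AT a point `y` of the chart source in the chart at `x`
  have reading : ∀ y ∈ c.source, ∀ U' : Set M, IsOpen U' → y ∈ U' → ∀ f' : M → (Fin (2 * p) → ℝ),
      ContMDiffOn 𝓘(ℝ, E) 𝓘(ℝ, Fin (2 * p) → ℝ) 1 f' U' →
      Function.Surjective (mfderiv 𝓘(ℝ, E) 𝓘(ℝ, Fin (2 * p) → ℝ) f' y) →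
      (∀ v : TangentSpace 𝓘(ℝ, E) y, mfderiv 𝓘(ℝ, E) 𝓘(ℝ, Fin (2 * p) → ℝ) f' y v = 0 →
        mfderiv 𝓘(ℝ, E) 𝓘(ℝ, Fin (2 * p) → ℝ) f' y (Literature.Geometry.Kaehler.tangentJ E y v) = 0) →
      ContDiffAt ℝ 1 (f' ∘ c.symm) (c y) ∧ Function.Surjective (fderiv ℝ (f' ∘ c.symm) (c y)) ∧
        ∀ v : E, fderiv ℝ (f' ∘ c.symm) (c y) v = 0 →
          fderiv ℝ (f' ∘ c.symm) (c y) (Complex.I • v) = 0 := by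
    intro y hys U' hU' hyU' f' hf' hsy hJy
    have h1 : ContDiffAt ℝ 1 (f' ∘ c.symm) (c y) :=
      (contDiffOn_extChartAt_symm_of_contMDiffOn hf' x).contDiffAt
        ((Literature.Geometry.Kaehler.isOpen_extChartAt_target_inter_preimage_symm x hU').mem_nhds
          ⟨c.map_source hys, by rw [mem_preimage, c.left_inv hys]; exact hyU'⟩)
    have hchain : mfderiv 𝓘(ℝ, E) 𝓘(ℝ, Fin (2 * p) → ℝ) f' y =
        (fderiv ℝ (f' ∘ c.symm) (c y)).comp (mfderiv 𝓘(ℝ, E) 𝓘(ℝ, E) c y) :=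
      mfderiv_eq_fderiv_comp_mfderiv_extChartAt_real hys (h1.differentiableAt one_ne_zero)
    obtain ⟨hDs, hDI⟩ := hD y hys
    refine ⟨h1, ?_, fun v hv => ?_⟩
    · rw [hchain] at hsy
      exact Function.Surjective.of_comp hsy
    · obtain ⟨t, ht⟩ := hDs v
      have h0 : mfderiv 𝓘(ℝ, E) 𝓘(ℝ, Fin (2 * p) → ℝ) f' y t = 0 := by
        rw [hchain]
        change fderiv ℝ (f' ∘ c.symm) (c y) (mfderiv 𝓘(ℝ, E) 𝓘(ℝ, E) c y t) = 0
        rw [ht, hv]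
      have h2 := hJy t h0
      rw [hchain] at h2
      change fderiv ℝ (f' ∘ c.symm) (c y)
        (mfderiv 𝓘(ℝ, E) 𝓘(ℝ, E) c y (Literature.Geometry.Kaehler.tangentJ E y t)) = 0 at h2
      rw [Literature.Geometry.Kaehler.tangentJ_apply, hDI t, ht] at h2
      exact h2
  -- Step 1: the defining submersion at `x`, read in the chart
  obtain ⟨U, hU, hxU, f, hf, hSU, hsx, hJx⟩ := hgood x hx
  set φ : E → (Fin (2 * p) → ℝ) := f ∘ c.symm with hφ
  have hW₁o : IsOpen (c.target ∩ c.symm ⁻¹' U) :=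
    Literature.Geometry.Kaehler.isOpen_extChartAt_target_inter_preimage_symm x hU
  have hφ₁ : ContDiffOn ℝ 1 φ (c.target ∩ c.symm ⁻¹' U) :=
    contDiffOn_extChartAt_symm_of_contMDiffOn hf x
  obtain ⟨hφa1, hφas, -⟩ := reading x hxs U hU hxU f hf hsx hJx
  -- Step 2: the submersive locus of `φ` near `c x`, and the open set `W`
  obtain ⟨W₂, hW₂, hW₂o, haW₂⟩ := eventually_nhds_iff.1 (stub_eventually_surjective_fderiv hφa1 hφas)
  set W : Set E := (c.target ∩ c.symm ⁻¹' (U ∩ Sgᶜ)) ∩ W₂ with hW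
  have hWo : IsOpen W :=
    (Literature.Geometry.Kaehler.isOpen_extChartAt_target_inter_preimage_symm x
      (hU.inter hSg.isOpen_compl)).inter hW₂o
  have haW : c x ∈ W :=
    ⟨⟨c.map_source hxs, by rw [mem_preimage, c.left_inv hxs]; exact ⟨hxU, hx.2⟩⟩, haW₂⟩
  have haS' : c x ∈ Literature.Geometry.Kaehler.chartImage 𝓘(ℂ, E) x S :=
    ⟨c.map_source hxs, by rw [mem_preimage, c.left_inv hxs]; exact hx.1⟩
  have hφW : ContDiffOn ℝ 1 φ W := hφ₁.mono fun e he => ⟨he.1.1, he.1.2.1⟩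
  have hSW : Literature.Geometry.Kaehler.chartImage 𝓘(ℂ, E) x S ∩ W = W ∩ φ ⁻¹' {0} := by
    ext e
    constructor
    · rintro ⟨⟨-, heS⟩, heW⟩
      refine ⟨heW, ?_⟩
      have h : c.symm e ∈ S ∩ U := ⟨heS, heW.1.2.1⟩
      rw [hSU] at h
      exact h.2
    · rintro ⟨heW, he0⟩
      refine ⟨⟨heW.1.1, ?_⟩, heW⟩
      have h : c.symm e ∈ U ∩ f ⁻¹' {0} := ⟨heW.1.2.1, he0⟩
      rw [← hSU] at h
      exact h.1
  -- Step 3: along `S` inside `W`, `dφ` is onto with `i`-stable kernel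
  have hreg : ∀ e ∈ Literature.Geometry.Kaehler.chartImage 𝓘(ℂ, E) x S ∩ W,
      Function.Surjective (fderiv ℝ φ e) ∧
        ∀ v : E, fderiv ℝ φ e v = 0 → fderiv ℝ φ e (Complex.I • v) = 0 := by
    rintro e ⟨⟨het, heS⟩, ⟨⟨-, heU, heSg⟩, heW₂⟩⟩
    have hse : Function.Surjective (fderiv ℝ φ e) := hW₂ e heW₂
    refine ⟨hse, fun v hv => ?_⟩
    -- the point `y = c.symm e ∈ S ∖ Sg` of the chart source, `c y = e`
    have hys : c.symm e ∈ c.source := c.map_target het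
    have hye : c (c.symm e) = e := c.right_inv het
    obtain ⟨U', hU', hyU', f', hf', hSU', hsy, hJy⟩ := hgood (c.symm e) ⟨heS, heSg⟩
    obtain ⟨hφ'1, hφ's, hφ'I⟩ := reading (c.symm e) hys U' hU' hyU' f' hf' hsy hJy
    rw [hye] at hφ'1 hφ's hφ'I
    have hφe1 : ContDiffAt ℝ 1 φ e := hφ₁.contDiffAt (hW₁o.mem_nhds ⟨het, heU⟩)
    -- the two chart readings cut out the same set near `e`
    have hφe0 : φ e = 0 := by
      have h : c.symm e ∈ S ∩ U := ⟨heS, heU⟩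
      rw [hSU] at h
      exact h.2
    have hφ'e0 : (f' ∘ c.symm) e = 0 := by
      have h : c.symm e ∈ S ∩ U' := ⟨heS, hyU'⟩
      rw [hSU'] at h
      exact h.2
    have hfib : ∀ᶠ z in 𝓝 e, (φ z = φ e ↔ (f' ∘ c.symm) z = (f' ∘ c.symm) e) := by
      have hO : IsOpen (c.target ∩ c.symm ⁻¹' (U ∩ U')) :=
        Literature.Geometry.Kaehler.isOpen_extChartAt_target_inter_preimage_symm x (hU.inter hU')
      filter_upwards [hO.mem_nhds ⟨het, heU, hyU'⟩] with z hz
      obtain ⟨-, hzU, hzU'⟩ := hz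
      rw [hφe0, hφ'e0]
      constructor
      · intro h0
        have h : c.symm z ∈ U ∩ f ⁻¹' {0} := ⟨hzU, h0⟩
        rw [← hSU] at h
        have h' : c.symm z ∈ S ∩ U' := ⟨h.1, hzU'⟩
        rw [hSU'] at h'
        exact h'.2
      · intro h0
        have h : c.symm z ∈ U' ∩ f' ⁻¹' {0} := ⟨hzU', h0⟩
        rw [← hSU'] at h
        have h' : c.symm z ∈ S ∩ U := ⟨h.1, hzU⟩
        rw [hSU] at h'
        exact h'.2
    have h1 : fderiv ℝ (f' ∘ c.symm) e v = 0 :=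
      stub_kerLeOfEqOnZeroSet hφe1 (hφ'1.differentiableAt one_ne_zero) hse
        (hfib.mono fun z hz h => hz.1 h) v hv
    exact stub_kerLeOfEqOnZeroSet hφ'1 (hφe1.differentiableAt one_ne_zero) hφ's
      (hfib.mono fun z hz h => hz.2 h) _ (hφ'I v h1)
  -- Step 4: Cauchy–Riemann core in the chart, and back to the manifold
  exact Literature.Geometry.Kaehler.isRegularPointOfCodim_of_isRegPt_chartImage hxs
    (stub_isRegPt_of_contDiffOn_complexKer hWo haS' haW hφW hSW hreg)

end Summit.HodgeConjecture.HodgeConjecture.Theorems
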